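import Mathlib
import Literature.Geometry.Riemannian.SphericalCylinderEntropy
import Literature.Geometry.Manifold.CylinderSlice
import Summits.SmoothPoincare4.SmoothPoincare4.Theses.CylinderEntropy
import HarnessLib.Audit

/-!
# Line `tilted-mean-convexity` — skeleton for crux `CylinderEntropy.CylinderRungTwo`
# (item stmt-SmoothPoincare4-7631), crux-plan of idea card `Ideas/tilted-mean-convexity.md`

**Crux (by name, never restated):** `Summit.SmoothPoincare4.SmoothPoincare4.Theses.CylinderEntropy.CylinderRungTwo` —
every smooth end-separating embedding `ι` of a homotopy 4-sphere `M` into `N = S⁴ × ℝ ⊂ ℝ⁶` with typed cylinder entropy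
`λ_cyl(range ι) < 4/e` has `M ≃ₘ S⁴`.

**Idea (card + triage r1-1/2/3, all pass).** For a cross-section `M = ∂K` (`K ∋` upper end, `ν` the unit normal into
`K`, `H = div ν`, `u = ⟪e₅, ν⟫`) the TILTED MEAN CONVEXITY `div ν < c·u` (class `𝒞₊(c)`, `c > 0`; `𝒞₋(c)`: `-c·u < div ν`)
says that `K` is strictly `X`-mean-convex for the Killing field `X = c ∂_s`.  Both `H` and `u` solve the Jacobi equation
`∂_t w = Δw + (|A|² + Ric(ν,ν)) w` along mean curvature flow in `N`, so the class is PRESERVED (stub 1), the translated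
level-set flow `F_t(K) + ct·e₅` is nested (Hershkovits–White, arXiv:1809.03026 §12 Thm 32) and White's mean-convex theory
runs with the drift `X` in the Riemannian 5-manifold `N` (White, arXiv:1107.4644 §4: partial regularity and convex type
"carry over", `n = 4 < 7`): every singularity is a multiplicity-one shrinking `S^j × ℝ^{4-j}`; Hamilton's monotonicity
in `N` (stub 2) bounds their Gaussian densities by `λ_cyl(M) < 4/e = λ(S²)`, so `j ∈ {3, 4}` (necks and round points);
the end-separating component is immortal and relaxes to a slice (stub 3); reading the sweep-out `K = {ũ ≥ 0}` of the
tilted arrival time backwards from a collar of the end, `K ∪ {+∞}` is a 5-dimensional 0/1-handlebody with connected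
boundary, so `M ≅ #k (S¹ × S³)` and `π₁(M) = 1` gives `k = 0` (stub 4 = the engine, `TiltedRungUp`).  The mushroom class
`𝒞₋` is the cavity class `𝒞₊` seen from the other end (stub 5, reflection `z₅ ↦ -z₅`).  Outside `𝒞₊ ∪ 𝒞₋` the line has
nothing to say: stub 6 (`stub_tiltAccessible`: a thin cross-section of `M` can be traded for a thin TILTED one of the
same `M`) is the crux-hard residual, conceded as such by the card ((c)) and by all three triagers; it is implied by the
crux (+ `SliceCalibration`), true for `M = S⁴` (the slice, `f = z₅`), and it is the only place where an exotic sphere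
can hide.

**Stubs (6, registered):** each is `theorem Holds.stub_<name> : <statement> := by sorry` plus the by-name handle
`def stub_<name> : Prop := type_of% Holds.stub_<name>` required by the layer-invariant audit (hypotheses of
`CylinderRungTwo_of` are admitted by head-constant name).
* `stub_tiltPreserved`   — `TiltPreservedN`: smooth level-set MCF in `N` preserves `div ν < c u` (max principle). [L]
* `stub_hamiltonMonotone` — `HamiltonMonotoneN`: `t ↦ F̂_{p, t₀-t}(M_t)` (the typed `cylDensity`) is non-increasing
                            along smooth level-set MCF in `N` (Hamilton 1993 + Harnack of the product kernel). [L]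
* `stub_immortalToSlice`  — `HamiltonMonotoneN → ImmortalToSliceN`: a smooth IMMORTAL connected end-separating flow with
                            `λ_cyl < 2` becomes a graph over `S⁴` (RELAXATION, shared with lines ground-state-relaxation /
                            killing-flux). [XL]
* `stub_tiltedRungUp`     — `TiltPreservedN → HamiltonMonotoneN → ImmortalToSliceN → TiltedRungUp`: the engine. [XL; lead]
* `stub_endReflection`    — `TiltedRungUp → TiltedRungDown` (isometry `z₅ ↦ -z₅` of `N`). [M]
* `stub_tiltAccessible`   — thin cross-section ⇒ thin tilted cross-section of the same `M`. [open-problem; residual]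

**Composition (kernel-checked, sorry-free):** `CylinderRungTwo_of : stub_tiltPreserved → stub_hamiltonMonotone →
stub_immortalToSlice → stub_tiltedRungUp → stub_endReflection → stub_tiltAccessible → CylinderRungTwo`: from the crux
hypotheses, accessibility yields `ι', f, c` with `ι'` thin and tilted; `TiltedRungUp` (from stubs 1–4) or its reflection
(stub 5) gives `M ≃ₘ S⁴`.  The crux's inline entropy is `cylEntropy (range ι)` by `rfl`.

**Disproof.lean honoured** (refuter-cdisprove-stmt-SmoothPoincare4-7631-0, via its seven evidence notes; the body is not
mounted on this hub): the sandwich `SPC4 ⇒ CylinderRungTwo` makes every stub that carries all crux hypotheses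
(`TiltedRungUp/Down`, accessibility) true-if-SPC4; the load-bearing `M ≃ₕ S⁴` is USED at `stub_tiltedRungUp` (connectedness
of `M` for the two-sided region `K`, and `π₁ = 1` to kill the `S¹ × S³` summands that tunnels in `𝒞₊` genuinely produce) —
without it the statement is false by the disprover's near-miss witness "slice ⊔ small sphere" (which IS tilted-convex:
`div ν = ∓4/r` on the small geodesic 4-sphere, `c < 4/r`); `rungWithoutHomotopyEntropy_false` (two slices) is respected: entropy is
used at `stub_tiltedRungUp` (`j ≥ 3`) and `stub_immortalToSlice` (`< 2` ⇒ one slice), connectedness is an explicit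
hypothesis of `ImmortalToSliceN`, and `IsDefiningFunction` is TWO-ENDED (`f < 0` at the lower end — the triage repair of
`fluxIdentity_false`).  No `Negative/` lemma has landed for this crux, so no stub instantiates one.
-/

noncomputable section

set_option linter.dupNamespace false

open scoped BigOperators Manifold ContDiff ENNReal Topology RealInnerProductSpace
open MeasureTheory Set ContinuousMap
open Literature.Geometry.Riemannian.SphericalCylinderEntropy (cylEntropy cylDensity)
open Literature.Geometry.Manifold.CylinderSlice (padL axis)

namespace Summit.SmoothPoincare4.SmoothPoincare4.Cruxes.CylinderRungTwo.TiltedMeanConvexity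

local notation "E5" => EuclideanSpace ℝ (Fin 5)
local notation "E6" => EuclideanSpace ℝ (Fin 6)

/-! ## Objects of the line (the card's vocabulary, `IdeateSketchK1.lean`, with the two-ended sign convention;
definition request: to land verbatim as `Literature/Geometry/Riemannian/CylinderLevelSetGeometry.lean`) -/

/-- The round cylinder `N = S⁴ × ℝ ⊂ ℝ⁶`, exactly as spelled in the route items. -/
def Ncyl : Set E6 := {z | ∑ i : Fin 5, z (Fin.castSucc i) ^ 2 = 1}

/-- `(z₀,…,z₄,0)`: for `z ∈ N` the outward unit normal of `N ⊂ ℝ⁶` at `z` (`axis = e₅` is the tree's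
`CylinderSlice.axis`). -/
def base (z : E6) : E6 := z - (z 5) • axis

/-- Gradient of `f : ℝ⁶ → ℝ` made tangential to `N` (remove the `base` component). -/
def gradN (f : E6 → ℝ) (z : E6) : E6 := gradient f z - ⟪gradient f z, base z⟫ • base z

/-- Unit normal, inside `N`, of the level hypersurface `{f = 0} ∩ N`, pointing into `{f > 0}`
(junk `0` where `gradN f = 0`). -/
def unitNormalN (f : E6 → ℝ) (z : E6) : E6 := ‖gradN f z‖⁻¹ • gradN f z

/-- Divergence along `N` of a vector field `V` on `ℝ⁶` tangent to `N`: trace of `dV` over `T_z N`. -/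
def divN (V : E6 → E6) (z : E6) : ℝ :=
  LinearMap.trace ℝ E6 (fderiv ℝ V z).toLinearMap - ⟪fderiv ℝ V z (base z), base z⟫

/-- Scalar mean curvature `div ν` (w.r.t. `ν = unitNormalN f`; sum of the four principal curvatures, slices
have `0`, a small geodesic sphere of `N` with outward `ν` has `+4/r`) of the level hypersurface of `f` in `N`. -/
def levelMeanCurvN (f : E6 → ℝ) (z : E6) : ℝ := divN (unitNormalN f) z

/-- `f` is a TWO-ENDED defining function of the cross-section `range ι` inside `N`: smooth, `{f = 0} ∩ N = range ι`,
non-degenerate along `range ι`, `f > 0` high up AND `f < 0` low down in `N` (so `{f ≥ 0} ∩ N` is the region `K`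
above the cross-section and `unitNormalN f` points into it; the lower clause is the triage repair of
`fluxIdentity_false`, harmless for connected `M`). -/
def IsDefiningFunction {M : Type*} (ι : M → E6) (f : E6 → ℝ) : Prop :=
  ContDiff ℝ ∞ f ∧ (∀ z ∈ Ncyl, (f z = 0 ↔ z ∈ Set.range ι)) ∧ (∀ x, gradN f (ι x) ≠ 0) ∧
    ∃ R : ℝ, (∀ z ∈ Ncyl, R ≤ z 5 → 0 < f z) ∧ (∀ z ∈ Ncyl, z 5 ≤ -R → f z < 0)

/-- Class `𝒞₊(c)` ("cavity type"): the region above `M` is strictly mean convex for the weight `e^{cs}`, i.e.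
`H⃗ + c ∂_s^⊥` points up: `div ν < c ⟪e₅, ν⟫` along `M`. -/
def TiltedConvexUp {M : Type*} (ι : M → E6) (f : E6 → ℝ) (c : ℝ) : Prop :=
  ∀ x, levelMeanCurvN f (ι x) < c * ⟪axis, unitNormalN f (ι x)⟫

/-- Class `𝒞₋(c)` ("mushroom type"): the region below `M` is strictly mean convex for the weight `e^{-cs}`:
`-c ⟪e₅, ν⟫ < div ν` along `M`. -/
def TiltedConvexDown {M : Type*} (ι : M → E6) (f : E6 → ℝ) (c : ℝ) : Prop :=
  ∀ x, -(c * ⟪axis, unitNormalN f (ι x)⟫) < levelMeanCurvN f (ι x)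

/-- **Smooth (classical) mean curvature flow of closed level hypersurfaces of `N` on `[0, T]`**, written with a global
level-set function: `F` is jointly `C^∞` on `ℝ × ℝ⁶`, the spacetime zero set over `[0,T] × N` is compact, and at every
zero `z ∈ N` of `F t` (`t ∈ [0,T]`) the tangential gradient is non-zero and `∂_t F = ‖∇_N F‖ · div ν` — i.e. the
hypersurface `M_t = {F t = 0} ∩ N` moves with normal velocity `-div(ν) ν = H⃗` (a small geodesic sphere of
radius `r` shrinks: `r' ≈ -4/r`).  Zeros of `F` off `N` are irrelevant. -/
def IsLevelSetMCFN (F : ℝ → E6 → ℝ) (T : ℝ) : Prop :=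
  ContDiff ℝ ∞ (fun q : ℝ × E6 => F q.1 q.2) ∧
  IsCompact {q : ℝ × E6 | q.1 ∈ Set.Icc 0 T ∧ q.2 ∈ Ncyl ∧ F q.1 q.2 = 0} ∧
  ∀ t ∈ Set.Icc 0 T, ∀ z ∈ Ncyl, F t z = 0 →
    gradN (F t) z ≠ 0 ∧ deriv (fun s => F s z) t = ‖gradN (F t) z‖ * levelMeanCurvN (F t) z

/-- **TiltPreservedN** (statement of stub 1): along a smooth level-set mean curvature flow in `N`, strict tilted mean
convexity `div ν < c ⟪e₅, ν⟫` of the moving hypersurface at time `0` persists on `[0, T]`, for every real `c`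
(`c = 0` is preservation of mean convexity).  Mechanism: `w = c⟪e₅,ν⟫ - div ν` solves
`∂_t w = Δ w + (|A|² + Ric_N(ν,ν)) w` (Huisken 1986 for `H`; `⟪V,ν⟫` for the Killing field `V = e₅`), maximum principle
on the closed hypersurfaces `M_t`. -/
def TiltPreservedN : Prop :=
  ∀ (F : ℝ → E6 → ℝ) (T c : ℝ), 0 ≤ T → IsLevelSetMCFN F T →
    (∀ z ∈ Ncyl, F 0 z = 0 → levelMeanCurvN (F 0) z < c * ⟪axis, unitNormalN (F 0) z⟫) →
    ∀ t ∈ Set.Icc 0 T, ∀ z ∈ Ncyl, F t z = 0 → levelMeanCurvN (F t) z < c * ⟪axis, unitNormalN (F t) z⟫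

/-- **HamiltonMonotoneN** (statement of stub 2): Hamilton's monotonicity formula in the cylinder for the typed
functional — along a smooth level-set mean curvature flow in `N`, for every centre `p ∈ N` and blow-up time `t₀`,
`t ↦ F̂_{p, t₀ - t}(M_t) = cylDensity {F t = 0} p (t₀ - t)` is non-increasing on `[0, T] ∩ (-∞, t₀)`
(the typed slice-normalised density IS Hamilton's `(4πτ)^{1/2} ∫ k dσ` for the backward heat kernel `k` of `N`; the
Harnack matrix `Hess log k + g/2τ` of the product kernel is the `S⁴` block of Hamilton's compact Einstein case `⊕ 0`). -/
def HamiltonMonotoneN : Prop :=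
  ∀ (F : ℝ → E6 → ℝ) (T : ℝ), 0 ≤ T → IsLevelSetMCFN F T →
    ∀ p ∈ Ncyl, ∀ t₀ s t : ℝ, 0 ≤ s → s ≤ t → t ≤ T → t < t₀ →
      cylDensity {z ∈ Ncyl | F t z = 0} p (t₀ - t) ≤ cylDensity {z ∈ Ncyl | F s z = 0} p (t₀ - s)

/-- **ImmortalToSliceN** (conclusion of stub 3; RELAXATION in smooth form): a smooth IMMORTAL level-set mean curvature
flow in `N` whose initial hypersurface is connected, separates the two ends (typed `JoinedIn` predicate, verbatim) and
has typed cylinder entropy `< 2` becomes, at some time `T`, a graph over `S⁴`: the vertical component of its normal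
vanishes nowhere and the hypersurface is `{(x, h x) : x ∈ S⁴}` for some `h`.  Mechanism: area decreases to a limit
`≥ vol(S⁴)` (area floor, tree `hausdorffMeasure_sphere_le_of_separatesEnds`), entropy is non-increasing (stub 2) and
dominates area ratios (tree `measure_ratio_le_cylEntropy`), the flow is slab-trapped (avoidance with static slices),
subsequential limits are stationary integral varifolds containing their top and bottom slices (strong maximum principle
against the slice foliation) hence — mass `< 2 vol(S⁴)` — ONE multiplicity-one slice; White/Brakke local regularity
upgrades to smooth graphical convergence, and max/min height monotonicity pins the slice. -/
def ImmortalToSliceN : Prop :=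
  ∀ (F : ℝ → E6 → ℝ), (∀ T : ℝ, 0 ≤ T → IsLevelSetMCFN F T) →
    IsConnected {z ∈ Ncyl | F 0 z = 0} →
    (∃ R : ℝ, ∀ a b : EuclideanSpace ℝ (Fin 6), ∑ i : Fin 5, a (Fin.castSucc i) ^ 2 = 1 →
      ∑ i : Fin 5, b (Fin.castSucc i) ^ 2 = 1 → a 5 ≤ -R → R ≤ b 5 →
      ¬ JoinedIn ({z : EuclideanSpace ℝ (Fin 6) | ∑ i : Fin 5, z (Fin.castSucc i) ^ 2 = 1} \
        {z ∈ Ncyl | F 0 z = 0}) a b) →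
    cylEntropy {z ∈ Ncyl | F 0 z = 0} < 2 →
    ∃ (T : ℝ) (h : Metric.sphere (0 : EuclideanSpace ℝ (Fin 5)) 1 → ℝ), 0 ≤ T ∧
      (∀ z ∈ Ncyl, F T z = 0 → ⟪axis, unitNormalN (F T) z⟫ ≠ 0) ∧
      {z ∈ Ncyl | F T z = 0} =
        Set.range (fun x : Metric.sphere (0 : EuclideanSpace ℝ (Fin 5)) 1 => padL (x : EuclideanSpace ℝ (Fin 5)) + h x • axis)

/-- **TiltedRungUp** (conclusion of stub 4 — the crux restricted to the cavity class `𝒞₊`): hypotheses 1–5 are those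
of `CylinderRungTwo` verbatim (entropy through the tree's `cylEntropy`, `rfl`-equal to the inline expression), plus a
two-ended defining function `f` and `c > 0` with `div ν < c ⟪e₅, ν⟫` along `range ι`; conclusion `M ≃ₘ S⁴`. -/
def TiltedRungUp : Prop :=
  ∀ (M : Type) [TopologicalSpace M] [T2Space M] [SecondCountableTopology M]
    [ChartedSpace (EuclideanSpace ℝ (Fin 4)) M] [IsManifold (𝓡 4) ∞ M],
    M ≃ₕ Metric.sphere (0 : EuclideanSpace ℝ (Fin 5)) 1 →
    ∀ ι : M → EuclideanSpace ℝ (Fin 6), Manifold.IsSmoothEmbedding (𝓡 4) (𝓡 6) ∞ ι →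
    (∀ x, ∑ i : Fin 5, ι x (Fin.castSucc i) ^ 2 = 1) →
    (∃ R : ℝ, ∀ a b : EuclideanSpace ℝ (Fin 6), ∑ i : Fin 5, a (Fin.castSucc i) ^ 2 = 1 →
      ∑ i : Fin 5, b (Fin.castSucc i) ^ 2 = 1 → a 5 ≤ -R → R ≤ b 5 →
      ¬ JoinedIn ({z : EuclideanSpace ℝ (Fin 6) | ∑ i : Fin 5, z (Fin.castSucc i) ^ 2 = 1} \ Set.range ι) a b) →
    cylEntropy (Set.range ι) < ENNReal.ofReal (4 / Real.exp 1) →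
    ∀ (f : E6 → ℝ) (c : ℝ), IsDefiningFunction ι f → 0 < c → TiltedConvexUp ι f c →
    Nonempty (M ≃ₘ⟮𝓡 4, 𝓡 4⟯ Metric.sphere (0 : EuclideanSpace ℝ (Fin 5)) 1)

/-- **TiltedRungDown**: the same for the mushroom class `𝒞₋` (`-c ⟪e₅, ν⟫ < div ν`). -/
def TiltedRungDown : Prop :=
  ∀ (M : Type) [TopologicalSpace M] [T2Space M] [SecondCountableTopology M]
    [ChartedSpace (EuclideanSpace ℝ (Fin 4)) M] [IsManifold (𝓡 4) ∞ M],
    M ≃ₕ Metric.sphere (0 : EuclideanSpace ℝ (Fin 5)) 1 →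
    ∀ ι : M → EuclideanSpace ℝ (Fin 6), Manifold.IsSmoothEmbedding (𝓡 4) (𝓡 6) ∞ ι →
    (∀ x, ∑ i : Fin 5, ι x (Fin.castSucc i) ^ 2 = 1) →
    (∃ R : ℝ, ∀ a b : EuclideanSpace ℝ (Fin 6), ∑ i : Fin 5, a (Fin.castSucc i) ^ 2 = 1 →
      ∑ i : Fin 5, b (Fin.castSucc i) ^ 2 = 1 → a 5 ≤ -R → R ≤ b 5 →
      ¬ JoinedIn ({z : EuclideanSpace ℝ (Fin 6) | ∑ i : Fin 5, z (Fin.castSucc i) ^ 2 = 1} \ Set.range ι) a b) →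
    cylEntropy (Set.range ι) < ENNReal.ofReal (4 / Real.exp 1) →
    ∀ (f : E6 → ℝ) (c : ℝ), IsDefiningFunction ι f → 0 < c → TiltedConvexDown ι f c →
    Nonempty (M ≃ₘ⟮𝓡 4, 𝓡 4⟯ Metric.sphere (0 : EuclideanSpace ℝ (Fin 5)) 1)

/-! ## The six registered stubs (sorried; `ledger skeleton check` registers `stub_<name>` with the statement as signature) -/

/-- **Stub 1 — TILT PRESERVATION (the first lemma of the line; triage r1-1/2/3 "stub first").**  `TiltPreservedN`:
`div ν < c⟪e₅,ν⟫` persists along smooth level-set MCF in `N`.  Why true: `H = div ν` and `u = ⟪e₅,ν⟫` (normal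
component of the Killing field `∂_s`) both solve `∂_t w = Δ w + (|A|² + Ric(ν,ν)) w`; the minimum of `w = cu - H` over the
closed `M_t` cannot reach `0` (Hamilton's trick).  The typed flow has compact spacetime track and non-degenerate
tangential gradient, so `M_t` is a proper isotopy of closed hypersurfaces (Ehresmann) — no sheet enters from infinity.
Why it might fail: only through the typing (it is Huisken 1986 §1 + the Killing–Jacobi identity).  Size L (the
evolution equations for a level-set flow in the coordinates of `ℝ⁶ ⊃ N` are not in Mathlib).
[Huisken, Invent. Math. 84 (1986) 463–480, Thm 1.1/Lemma evolution of `H`; doi:10.4310/cag.1993.v1.n1.a7] -/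
theorem Holds.stub_tiltPreserved : TiltPreservedN := by
  sorry

/-- **Stub 2 — HAMILTON MONOTONICITY IN THE CYLINDER (route-level standing lemma, smooth form).**  `HamiltonMonotoneN`.
Why true: Hamilton's monotonicity formula for MCF in a Riemannian ambient with a positive backward heat solution `k`,
`d/dt (4πτ)^{1/2}∫_{M_t} k = -(4πτ)^{1/2}∫ (|H⃗ - ∇^⊥ log k|² + (Hess log k + g/2τ)(ν,ν)) k ≤ 0` once Hamilton's
matrix Harnack form is `≥ 0`; for the product kernel of `N = S⁴ × ℝ` the form is block-diagonal: the `S⁴` block is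
Hamilton's compact case (`sec ≥ 0`, `∇Ric = 0`), the `ℝ` block vanishes identically; the typed `cylDensity` is exactly
`(4πτ)^{1/2}∫ k` (slices calibrated to `1`), and the typed Gegenbauer series is `vol(S⁴)·H_{S⁴}` (positivity = heat-kernel
positivity).  Numerically the form is even coercive (min eigenvalue `0.4147` for `τ ≤ 1`, `1/2τ - O(e^{-4τ})` beyond;
HarnackNumericsK3.md, TRIAGE-r1-2/3).  Why it might fail: a sign slip in identifying the typed series with the heat
kernel (guarded by `SliceCalibration`, item 7634).  Size L.
[doi:10.4310/cag.1993.v1.n1.a7 Thm 1.1 (MCF case); doi:10.4310/cag.1993.v1.n1.a6 (matrix Harnack); Huisken1990] -/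
theorem Holds.stub_hamiltonMonotone : HamiltonMonotoneN := by
  sorry

/-- **Stub 3 — IMMORTAL RELAXATION TO A SLICE (smooth form; shared with lines ground-state-relaxation / killing-flux,
whose first lemma A1 = tree `measure_ratio_le_cylEntropy` is already proved).**  `HamiltonMonotoneN → ImmortalToSliceN`.
Why true: see the docstring of `ImmortalToSliceN` (triage r1-1/2/3 checked the squeeze step by step: threshold `2`,
topology-free).  Inputs by name: tree `hausdorffMeasure_sphere_le_of_separatesEnds`, `measure_ratio_le_cylEntropy`,
`one_sub_tail_le_zonal`; Solomon–White strong maximum principle; Brakke/White local regularity; Allard.  Why it might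
fail: an immortal smooth flow converging to a slice with multiplicity one but with an infinite-time loss of
graphicality is excluded by smooth convergence — the risk is only bookkeeping (uniformity of White's regularity at
scales `≈ inj(N) = π`).  Size XL (no varifolds in Mathlib; the statement itself is classical-PDE-typed).
[White, Ann. Math. 161 (2005) doi:10.4007/annals.2005.161.1487; Solomon–White 1989; doi:10.4310/cag.1993.v1.n1.a7;
Allard 1972] -/
theorem Holds.stub_immortalToSlice : HamiltonMonotoneN → ImmortalToSliceN := by
  sorry

/-- **Stub 4 — THE TILTED RUNG, cavity class (the ENGINE of the line; lead's stub).**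
`TiltPreservedN → HamiltonMonotoneN → ImmortalToSliceN → TiltedRungUp`.  Proof template: `K := {f ≥ 0} ∩ N` is a closed
region with compact boundary `range ι`, containing the upper end, strictly `X`-mean-convex for `X = c e₅`
(`TiltedConvexUp`); (i) HW-avoidance Thm 32 (complete `N`, `Ric ≥ 0`, `∇X = 0`): the biggest `X`-flow `K̃(t) = F_t(K) + ct e₅`
is nested with continuous arrival time `ũ : K → [0,∞)` (`ũ < ∞` since `F_t(K) ⊆ {s ≥ min}` escapes upward), and
`∂F_t(K) = M_t` separates the ends at every `t` (it bounds a region containing exactly one end); (ii) White 2000/2003/2013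
with drift (arXiv:1107.4644 §4, `n = 4 < 7`): `M_t` is a unit-regular flow whose singularities have CONVEX TYPE,
multiplicity one, tangent flows `S^j × ℝ^{4-j}`; (iii) stub 2 ⇒ Gaussian densities `≤ λ_cyl(range ι) < 4/e = λ(S²)`
(tree `sphereEntropy_two`), so `j ∈ {3,4}`: necks `S³ × ℝ` and round points only (CM12 Thm 0.17 values, Stone); (iv)
debris (non-separating components) dies in finite time (area budget `< (4/e - 1)·vol S⁴ <  vol S⁴` + clearing out), the
separating component's entropy drops below `λ(S⁴)` (relaxation, weak form) after which the flow is smooth, and stub 3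
makes it a graph: `K̃(T) ≅ S⁴ × [0, ∞)`; (v) bookkeeping through neck/round-point singularities (CHHW canonical
neighbourhoods, arXiv:1910.00639 Thm 1.17/Cor 1.18, valid in arbitrary ambient; Daniels–Holgate surgery or
Colding–Minicozzi arrival-time Morse theory PORTED to `N`): `K ∪ {+∞}` = collar ∪ 0-handles ∪ 1-handles with connected
boundary `= ♮k (S¹ × B⁴)`, so `M ≅ #k(S¹ × S³)`; (vi) `M ≃ₕ S⁴` ⇒ `π₁ = 1` ⇒ `k = 0` ⇒ `M ≅ S⁴` (uses `M ≃ₕ S⁴` exactly here and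
for connectedness; without it the disprover's "slice ⊔ small sphere" is a tilted-convex counterexample).  Why it might
fail: items (d)–(f) of Hershkovits–White GT 2019 Thm 4 for `X`-flows are deferred to the unpublished [HW_X_mean_convex]
(White 2013 §4 asserts the port "with minor modifications" for `n < 7`); the DIFFEOMORPHISM bookkeeping (v) for a drift
flow in `N` is classical-type work not in print (Daniels–Holgate and Mramor–Wang are Euclidean, Brendle–Huisken is
3-dimensional).  Size XL.
[arXiv:1809.03026 Thm 32; arXiv:1107.4644 Thm 1.1 + §4; arXiv:1803.00637 §3 Thm 4, Rem 5; White JAMS 13 (2000), JAMS 16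
(2003); arXiv:1508.00840; arXiv:1910.00639 Thm 1.17; DanielsHolgate2022; arXiv:1501.07899; doi:10.1007/s00526-021-01947-1;
ChodoshMantoulidisSchulze2025 Cor 1.5(b); White CAG 3 (1995) Thm 1] -/
theorem Holds.stub_tiltedRungUp : TiltPreservedN → HamiltonMonotoneN → ImmortalToSliceN → TiltedRungUp := by
  sorry

/-- **Stub 5 — END REFLECTION.** `TiltedRungUp → TiltedRungDown`: the isometry `σ(z) = (z₀,…,z₄,-z₅)` of `ℝ⁶` preserves
`N`, swaps its ends, fixes `base`, and transports the data: `ι ↦ σ ∘ ι` (smooth embedding into `N`, separating,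
`cylEntropy (σ '' A) = cylEntropy A` since `cylKernel p τ (σ z) = cylKernel (σ p) τ z` and `μH[4]` is `σ`-invariant),
`f ↦ g := -(f ∘ σ)` (two-ended defining function of `range (σ ∘ ι)` — this is where the lower sign clause of
`IsDefiningFunction` is used), `unitNormalN g = -σ ∘ unitNormalN f ∘ σ`, `levelMeanCurvN g ∘ σ = -levelMeanCurvN f`,
`⟪e₅, unitNormalN g (σ z)⟫ = ⟪e₅, unitNormalN f z⟫`; hence `TiltedConvexDown ι f c ↔ TiltedConvexUp (σ ∘ ι) g c`, and
`TiltedRungUp` applied to the reflected data gives `M ≃ₘ S⁴`.  Why it might fail: it cannot (pure symmetry); the Lean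
cost is the change of variables in the typed `lintegral`/`iSup`.  Size M. [folklore; tree `CylinderSlice`,
`SphericalCylinderEntropy.cylKernel_eq`] -/
theorem Holds.stub_endReflection : TiltedRungUp → TiltedRungDown := by
  sorry

/-- **Stub 6 — TILT ACCESSIBILITY (the residual; crux-hard, NOT a work target beyond the standard sanity case).**
Every homotopy 4-sphere `M` with a thin cross-section embedding (hypotheses of the crux, verbatim; entropy via
`cylEntropy`) admits a thin cross-section embedding `ι'` of the SAME `M` that is tilted mean convex for some two-ended
defining function `f` and `c > 0` (either class).  True for `M = S⁴`: `ι' =` the slice `x ↦ (x, 0)`, `f z = z₅`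
(`gradN f = e₅`, `unitNormalN f ≡ e₅`, `div ν = 0 < c`), thin by `SliceCalibration` (`λ_cyl(slice) = 1 < 4/e`, item 7634);
implied by the crux (`M ≅ S⁴` ⇒ transport the slice); conversely, given stubs 1–5 it is EQUIVALENT to the crux, so for an
exotic `M` it fails exactly when the crux does (cdisprove sandwich: `¬crux ⇔` an exotic sphere with a thin
cross-section).  The card's form "(isotopy through thin cross-sections into `𝒞₊ ∪ 𝒞₋`)" is deliberately weakened to
bare existence.  Why it might fail: it is SPC4-for-thin-spheres in another costume-free but equally hard form; no flow
or h-principle moving a thin cross-section into the cone is known (the cone excludes "mushroom next to cavity").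
Size: open problem. [ChodoshMantoulidisSchulze2025 Cor 1.5(b) (the Euclidean analogue of what it replaces);
KervaireMilnorAnnals1963] -/
theorem Holds.stub_tiltAccessible :
  ∀ (M : Type) [TopologicalSpace M] [T2Space M] [SecondCountableTopology M]
    [ChartedSpace (EuclideanSpace ℝ (Fin 4)) M] [IsManifold (𝓡 4) ∞ M],
    M ≃ₕ Metric.sphere (0 : EuclideanSpace ℝ (Fin 5)) 1 →
    ∀ ι : M → EuclideanSpace ℝ (Fin 6), Manifold.IsSmoothEmbedding (𝓡 4) (𝓡 6) ∞ ι →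
    (∀ x, ∑ i : Fin 5, ι x (Fin.castSucc i) ^ 2 = 1) →
    (∃ R : ℝ, ∀ a b : EuclideanSpace ℝ (Fin 6), ∑ i : Fin 5, a (Fin.castSucc i) ^ 2 = 1 →
      ∑ i : Fin 5, b (Fin.castSucc i) ^ 2 = 1 → a 5 ≤ -R → R ≤ b 5 →
      ¬ JoinedIn ({z : EuclideanSpace ℝ (Fin 6) | ∑ i : Fin 5, z (Fin.castSucc i) ^ 2 = 1} \ Set.range ι) a b) →
    cylEntropy (Set.range ι) < ENNReal.ofReal (4 / Real.exp 1) →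
    ∃ ι' : M → EuclideanSpace ℝ (Fin 6), Manifold.IsSmoothEmbedding (𝓡 4) (𝓡 6) ∞ ι' ∧
      (∀ x, ∑ i : Fin 5, ι' x (Fin.castSucc i) ^ 2 = 1) ∧
      (∃ R : ℝ, ∀ a b : EuclideanSpace ℝ (Fin 6), ∑ i : Fin 5, a (Fin.castSucc i) ^ 2 = 1 →
        ∑ i : Fin 5, b (Fin.castSucc i) ^ 2 = 1 → a 5 ≤ -R → R ≤ b 5 →
        ¬ JoinedIn ({z : EuclideanSpace ℝ (Fin 6) | ∑ i : Fin 5, z (Fin.castSucc i) ^ 2 = 1} \ Set.range ι') a b) ∧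
      cylEntropy (Set.range ι') < ENNReal.ofReal (4 / Real.exp 1) ∧
      ∃ (f : EuclideanSpace ℝ (Fin 6) → ℝ) (c : ℝ), IsDefiningFunction ι' f ∧ 0 < c ∧
        (TiltedConvexUp ι' f c ∨ TiltedConvexDown ι' f c) := by
  sorry

/-! ### By-name handles of the six statements (the audit admits a hypothesis of `CylinderRungTwo_of` only if its head
constant is a registered obligation by name; `@[stub]` is gate-reserved) -/

/-- Statement of registered stub 1 (`Holds.stub_tiltPreserved`), by name. -/
def stub_tiltPreserved : Prop := type_of% Holds.stub_tiltPreserved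

/-- Statement of registered stub 2 (`Holds.stub_hamiltonMonotone`), by name. -/
def stub_hamiltonMonotone : Prop := type_of% Holds.stub_hamiltonMonotone

/-- Statement of registered stub 3 (`Holds.stub_immortalToSlice`), by name. -/
def stub_immortalToSlice : Prop := type_of% Holds.stub_immortalToSlice

/-- Statement of registered stub 4 (`Holds.stub_tiltedRungUp`), by name. -/
def stub_tiltedRungUp : Prop := type_of% Holds.stub_tiltedRungUp

/-- Statement of registered stub 5 (`Holds.stub_endReflection`), by name. -/
def stub_endReflection : Prop := type_of% Holds.stub_endReflection

/-- Statement of registered stub 6 (`Holds.stub_tiltAccessible`), by name. -/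
def stub_tiltAccessible : Prop := type_of% Holds.stub_tiltAccessible

/-! ## Glue (sorry-free) -/

/-- Stubs 1–4 give the tilted rung for the cavity class. -/
theorem tiltedRungUp_of (h₁ : stub_tiltPreserved) (h₂ : stub_hamiltonMonotone) (h₃ : stub_immortalToSlice)
    (h₄ : stub_tiltedRungUp) : TiltedRungUp :=
  h₄ h₁ h₂ (h₃ h₂)

/-- Stubs 1–5 give the tilted rung for both classes (the card's `TiltedRung`). -/
theorem tiltedRung_of (h₁ : stub_tiltPreserved) (h₂ : stub_hamiltonMonotone) (h₃ : stub_immortalToSlice)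
    (h₄ : stub_tiltedRungUp) (h₅ : stub_endReflection) :
    ∀ (M : Type) [TopologicalSpace M] [T2Space M] [SecondCountableTopology M]
      [ChartedSpace (EuclideanSpace ℝ (Fin 4)) M] [IsManifold (𝓡 4) ∞ M],
      M ≃ₕ Metric.sphere (0 : EuclideanSpace ℝ (Fin 5)) 1 →
      ∀ ι : M → EuclideanSpace ℝ (Fin 6), Manifold.IsSmoothEmbedding (𝓡 4) (𝓡 6) ∞ ι →
      (∀ x, ∑ i : Fin 5, ι x (Fin.castSucc i) ^ 2 = 1) →
      (∃ R : ℝ, ∀ a b : EuclideanSpace ℝ (Fin 6), ∑ i : Fin 5, a (Fin.castSucc i) ^ 2 = 1 →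
        ∑ i : Fin 5, b (Fin.castSucc i) ^ 2 = 1 → a 5 ≤ -R → R ≤ b 5 →
        ¬ JoinedIn ({z : EuclideanSpace ℝ (Fin 6) | ∑ i : Fin 5, z (Fin.castSucc i) ^ 2 = 1} \ Set.range ι) a b) →
      cylEntropy (Set.range ι) < ENNReal.ofReal (4 / Real.exp 1) →
      ∀ (f : E6 → ℝ) (c : ℝ), IsDefiningFunction ι f → 0 < c →
        (TiltedConvexUp ι f c ∨ TiltedConvexDown ι f c) →
        Nonempty (M ≃ₘ⟮𝓡 4, 𝓡 4⟯ Metric.sphere (0 : EuclideanSpace ℝ (Fin 5)) 1) := by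
  intro M _ _ _ _ _ e ι hι hN hsep hthin f c hf hc htilt
  have hup : TiltedRungUp := tiltedRungUp_of h₁ h₂ h₃ h₄
  rcases htilt with h | h
  · exact hup M e ι hι hN hsep hthin f c hf hc h
  · exact (h₅ hup) M e ι hι hN hsep hthin f c hf hc h

/-- **The composition.** The six stubs imply the crux `CylinderEntropy.CylinderRungTwo` BY NAME. -/
theorem CylinderRungTwo_of (h₁ : stub_tiltPreserved) (h₂ : stub_hamiltonMonotone) (h₃ : stub_immortalToSlice)
    (h₄ : stub_tiltedRungUp) (h₅ : stub_endReflection) (h₆ : stub_tiltAccessible) :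
    Summit.SmoothPoincare4.SmoothPoincare4.Theses.CylinderEntropy.CylinderRungTwo := by
  intro M _ _ _ _ _ e ι hι hN hsep hthin
  -- the crux's inline entropy is the tree's `cylEntropy (range ι)` by `rfl`
  have hthin' : cylEntropy (Set.range ι) < ENNReal.ofReal (4 / Real.exp 1) := hthin
  obtain ⟨ι', hι', hN', hsep', hthin'', f, c, hf, hc, htilt⟩ := h₆ M e ι hι hN hsep hthin'
  exact tiltedRung_of h₁ h₂ h₃ h₄ h₅ M e ι' hι' hN' hsep' hthin'' f c hf hc htilt

/-- The skeleton as the crux proof modulo the registered stubs (D-0027 §3.3 shape), kept as an `example` so that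
`CylinderRungTwo_of` is the unique theorem concluding the crux; the lead turns it into `theorem CylinderRungTwo_proof`
when the last stub lands. -/
example : Summit.SmoothPoincare4.SmoothPoincare4.Theses.CylinderEntropy.CylinderRungTwo :=
  CylinderRungTwo_of Holds.stub_tiltPreserved Holds.stub_hamiltonMonotone Holds.stub_immortalToSlice
    Holds.stub_tiltedRungUp Holds.stub_endReflection Holds.stub_tiltAccessible

/-! ## Sanity (sorry-free): the engine's target is a genuine special case of the crux, so it is TRUE if SPC4 -/

/-- `TiltedRungUp` is implied by the crux (it only adds hypotheses). -/
theorem tiltedRungUp_of_crux (h : Summit.SmoothPoincare4.SmoothPoincare4.Theses.CylinderEntropy.CylinderRungTwo) :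
    TiltedRungUp := by
  intro M _ _ _ _ _ e ι hι hN hsep hthin _ _ _ _ _
  exact h M e ι hι hN hsep hthin

/-- `TiltedRungDown` is implied by the crux. -/
theorem tiltedRungDown_of_crux (h : Summit.SmoothPoincare4.SmoothPoincare4.Theses.CylinderEntropy.CylinderRungTwo) :
    TiltedRungDown := by
  intro M _ _ _ _ _ e ι hι hN hsep hthin _ _ _ _ _
  exact h M e ι hι hN hsep hthin

end Summit.SmoothPoincare4.SmoothPoincare4.Cruxes.CylinderRungTwo.TiltedMeanConvexity

end
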